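import Summits.BirchSwinnertonDyer.BirchSwinnertonDyer.Theorems.Rank2ShaOrderCertificate
import Literature.NumberTheory.EllipticCurves.Rank1Residual.X9NoEntry
import Literature.NumberTheory.EllipticCurves.Rank1Residual.PrintShape
import HarnessLib

/-!
# BirchSwinnertonDyer — rank-2 `Ш[p^∞]` cell: the ROW THEOREM `#Ш(E/ℚ)[p^∞] = p^k` under
# Skinner–Urban's printed hypotheses (`p ≥ 5`, and `p = 3` with Wuthrich's Lemma 20)

HONEST FRAMING (cell `b2b-bsdr2sha`, run/shared/lean/b2b/bsd-rank2-sha/): per-pair certified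
theorems «cited hypotheses ∧ certified computation ⇒ `Ш(E/ℚ)[p^∞]` finite of order `p^k`» for
rank-2 curves at good ordinary primes; NO claim on BSD in rank `≥ 2`, no class-level theorem, every
published input is a NAMED HYPOTHESIS of the tree (nothing is asserted or minted here).

Companion of `Rank2ShaOrderCertificate.lean` (the identity (★)
`ord_p #Ш(E/ℚ)[p^∞] = ord_p [T^r]L_p + r + 2·ord_p #E(ℚ)_tors − 2·ord_p #Ẽ(𝔽_p) − ord_p ∏c_ℓ − ord_p Reg_p`
from `skinner_urban_main_conjecture` (integral clause) and `Schneider1985_order_charGenerator_odd`,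
given `ρ̄_{E,p^n}` surjective for all `n`). THIS file discharges the surjectivity: under the printed
bullets of Skinner–Urban, Invent. Math. 195 (2014), Thm. 3.6.9 — good ordinary `p`, `E[p]` irreducible
(`Irr W p`), a multiplicative `ℓ ≠ p` with `p ∤ v_ℓ(Δ_min)` (`Ram W p`) — the mod-`p` representation is
surjective by the tree THEOREM `surj_of_irr_of_ram` (inertia at `ℓ` acts through a transvection of
order `p`, Tate curve; a proper irreducible subgroup of `GL₂(𝔽_p)` with surjective determinant has
order prime to `p`, Serre 1972 Prop. 15), and `ρ_{E,p^∞}` is surjective by Serre (IV §3.4) at `p ≥ 5`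
(tree theorem `serre_hasSurjectiveModNGaloisRep_pow_holds`) resp. by Wuthrich, Doc. Math. 19 (2014),
Lemma 20 at a good prime `p = 3` (named fact `lemma20_surjective_threeAdic_of_semistable`). Hence:

* `hasSurjectiveModNGaloisRep_pow_of_irr_of_ram` — `p ≥ 5`, `Irr`, `Ram` ⇒ `ρ̄_{E,p^n}` onto, all `n`.
* `card_shaPrimary_eq_pow_of_certificate` — THE ROW THEOREM at `p ≥ 5`: named facts `hSU`, `hS`;
  per curve `IsOrdinaryAt W p`, `Irr W p`, `Ram W p`, the newform `hf`; certified computation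
  `r ≤ rank` (`hlow`), `[T^r] L_p ≠ 0` with `ord_p [T^r] L_p = a` (`hLp`, `hcoeff`), `ord_p Reg_p(E,Dh) = b`
  for THE canonical height `Dh`. OUTPUT: `rank = r`, `Ш(E/ℚ)[p^∞]` finite, `Reg_p ≠ 0`,
  `#Ш(E/ℚ)[p^∞] = p^k`, `k = a + r − 2·ord_p #Ẽ(𝔽_p) − ord_p ∏c_ℓ − b` (no torsion term under `Irr`;
  = the census exponent `b_p` of SW13 Alg. 11.1 step 4 at `r = 2`).
* `card_shaPrimary_eq_pow_of_certificate'` — the same quantified over THE (unique, existing) canonical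
  height datum (`existsUnique_isCanonical_holds`), for rows that quote `b` without naming `Dh`.
* `card_shaPrimary_eq_pow_of_certificate_three` — the row theorem at `p = 3` (extra named fact `hW20`,
  `Dh` a parameter).

A row `(E, p)` of the cell's census either instantiates one of these (every hypothesis discharged by a
kernel certificate — `Rank1ResidualIntModelReduction.lean`: `ram_of_intModel`,
`hasIrreducibleModPGaloisRep_of_intModel_of_noroot`; `Rank2ObservatoryPadicAtlasKit.lean`: good
ordinary, `#Ẽ(𝔽_p)`; `Rank2Observatory<label>RankTwo.lean`: `rank = 2` — or by a labelled two-engine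
datum) or names the FAILING printed hypothesis (`¬Irr`: Eisenstein prime; `¬Ram`: no multiplicative
`ℓ` with `p ∤ v_ℓ(Δ_min)`; `p ∣ a_p`; `p ∣ N`). Per pair; NOT a class theorem.

References: C. Skinner, E. Urban, Invent. Math. 195 (2014), Thm. 3.6.9 (p. 45) [SkinnerUrban2014];
J. Balakrishnan, J. S. Müller, W. Stein, Math. Comp. 85 (2016), Thm. 1.7 [BalakrishnanMullerStein2015];
W. Stein, C. Wuthrich, Math. Comp. 82 (2013), §§3–4, §8, Alg. 11.1 [SteinWuthrich2013]; J.-P. Serre,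
Invent. Math. 15 (1972), Prop. 15, IV §3.4 [Serre1972]; C. Wuthrich, Doc. Math. 19 (2014), Lemma 20
[Wuthrich2014]; B. Mazur, W. Stein, J. Tate, Doc. Math. Extra Vol. (2006), Thm. 1.3 [MazurSteinTate2006];
K. Kato, Astérisque 295 (2004), Thm. 17.4 [Kato2004Asterisque].
-/

set_option autoImplicit false

-- single-conjunct summit: `Summit.BirchSwinnertonDyer.BirchSwinnertonDyer.…` repeats the name by design
set_option linter.dupNamespace false

noncomputable section

open scoped Classical MatrixGroups ModularForm

open CongruenceSubgroup WeierstrassCurve Literature.NumberTheory.EllipticCurves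
  Literature.NumberTheory.EllipticCurves.ModularForms
  Literature.NumberTheory.EllipticCurves.Rank1Residual
  Literature.NumberTheory.EllipticCurves.Wuthrich2014

namespace Summit.BirchSwinnertonDyer.BirchSwinnertonDyer.Rank2Sha

/-! ## §1. The row theorem at `p ≥ 5`: Skinner–Urban's printed hypotheses and the census data -/

/-- **`ρ_{E,p^∞}` is surjective under Skinner–Urban's printed hypotheses at `p ≥ 5`**: `Irr W p` and
`Ram W p` give `ρ̄_{E,p}` surjective (tree THEOREM `surj_of_irr_of_ram`: inertia at the multiplicative
`ℓ` supplies a transvection, Serre 1972 Prop. 15), and at `p ≥ 5` mod-`p` surjectivity lifts to every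
`p^n` (Serre, tree theorem `serre_hasSurjectiveModNGaloisRep_pow_holds`). So the integral clause of
Thm. 3.6.9 ("If the image of `ρ_{E,p}` is surjective, then this equality holds in `Λ_ℚ`") is available
at EVERY row satisfying the theorem's displayed bullets. [cite: SkinnerUrban2014, Thm. 3.6.9 (p. 45)]
[cite: Serre1972, §2.4 Prop. 15 and IV §3.4] -/
theorem hasSurjectiveModNGaloisRep_pow_of_irr_of_ram
    (W : WeierstrassCurve ℚ) [W.IsElliptic] [W.IsGloballyMinimal] (p : ℕ) [Fact p.Prime]
    (h5 : 5 ≤ p) (hirr : W.HasIrreducibleModPGaloisRep p) (hram : Ram W p) :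
    ∀ n : ℕ, W.HasSurjectiveModNGaloisRep (p ^ n : ℕ) :=
  serre_hasSurjectiveModNGaloisRep_pow_holds W p h5 (surj_of_irr_of_ram W p hirr hram)

/-- **THE ROW THEOREM: `#Ш(E/ℚ)[p^∞] = p^k` at a certified rank-`r` cell `(E, p)`, `p ≥ 5`.**
HYPOTHESES, cited: `hSU` — Skinner–Urban 2014 Thm. 3.6.9 for every cyclotomic datum (tree named fact
`skinner_urban_main_conjecture`; its divisibility half is Kato 2004 Thm. 17.4); `hS` —
Perrin-Riou–Schneider as printed by Balakrishnan–Müller–Stein 2016 Thm. 1.7, `p > 2` (tree named fact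
`Schneider1985_order_charGenerator_odd`). HYPOTHESES, per curve, EXACTLY the printed bullets of
Thm. 3.6.9: `p ≥ 5` good ordinary (`hordin`), `E[p]` irreducible (`hirr`), a multiplicative prime
`ℓ ≠ p` with `p ∤ v_ℓ(Δ_min)` (`hram`); plus the newform `hf`. CERTIFIED COMPUTATION: `r ≤ rank_ℤ E(ℚ)`
(`hlow`), `[T^r] L_p ≠ 0` with `ord_p [T^r] L_p = a` (`hLp`, `hcoeff`), `ord_p Reg_p(E, Dh) = b` for THE
canonical height datum `Dh` (`hDh`, `hreg`; unique, `existsUnique_isCanonical_holds`). CONCLUSION: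
`rank_ℤ E(ℚ) = r`, `Ш(E/ℚ)[p^∞]` is finite and `#Ш(E/ℚ)[p^∞] = p^k`,
`k = a + r − 2·ord_p #Ẽ(𝔽_p) − ord_p ∏c_ℓ − b` — NO torsion term: `E[p]` irreducible forces
`p ∤ #E(ℚ)_tors` (tree theorem `padicValNat_torsionOrder_eq_zero_of_irreducible`, Mazur 1977 p. 157); with
`r = 2`, `ord_p ε_p = 2·ord_p #Ẽ(𝔽_p)` and `ord_p Reg_γ = b − 2` this `k` IS the census exponent
`b_p = ord_p c₂ − ord_p ε_p − Σ ord_p c_υ − ord_p Reg_γ` of Stein–Wuthrich Alg. 11.1 step 4. Per pair; NOT a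
class theorem; the integers `#Ẽ(𝔽_p)`, `∏c_ℓ` stay symbolic (a row instantiates them by its own
certificates). [cite: SkinnerUrban2014, Thm. 3.6.9 (p. 45)] [cite: BalakrishnanMullerStein2015, Thm. 1.7]
[cite: SteinWuthrich2013, §§3–4, §8 and Alg. 11.1] [cite: Kato2004Asterisque, Thm. 17.4 (p. 273)] -/
theorem card_shaPrimary_eq_pow_of_certificate
    (hS : Schneider1985_order_charGenerator_odd)
    (W : WeierstrassCurve ℚ) [W.IsElliptic] [W.IsGloballyMinimal] (p : ℕ) [Fact p.Prime]
    {N : ℕ} [NeZero N] (f : CuspForm (Gamma0 N) 2)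
    (hSU : ∀ (κ : ZpExtension ℚ p) (γ : Field.absoluteGaloisGroup ℚ),
      skinner_urban_main_conjecture W p (κ := κ) (γ := γ) (f := f))
    (h5 : 5 ≤ p) (hordin : IsOrdinaryAt W p) (hirr : W.HasIrreducibleModPGaloisRep p)
    (hram : Ram W p) (hf : IsNewformOf W f)
    {r : ℕ} (hlow : r ≤ W.mordellWeilRank)
    (hLp : PowerSeries.coeff r (padicLFunction f (unitRoot W p : ℚ_[p])) ≠ 0)
    (Dh : PAdicHeightData W p) (hDh : Dh.IsCanonical) {a b : ℤ}
    (hcoeff : (PowerSeries.coeff r (padicLFunction f (unitRoot W p : ℚ_[p]))).valuation = a)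
    (hreg : (padicRegulator Dh).valuation = b) :
    W.mordellWeilRank = r ∧ Finite (AddCommGroup.primaryComponent W.sha p) ∧
      SchneiderConjecture Dh ∧
      ∃ k : ℕ, Nat.card (AddCommGroup.primaryComponent W.sha p) = p ^ k ∧
        (k : ℤ) = a + r - 2 * padicValNat p (W.reductionPointCount p) -
          padicValNat p W.tamagawaProduct - b := by
  have hp : 3 ≤ p := by omega
  have hsurj := hasSurjectiveModNGaloisRep_pow_of_irr_of_ram W p h5 hirr hram
  obtain ⟨hr, hord⟩ := rank_eq_and_order_eq_of_mainConjecture W p f hSU hp hordin.1 hordin.2 hirr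
    hram hsurj hf hlow hLp
  have hord' : (padicLFunction f (unitRoot W p : ℚ_[p])).order = W.mordellWeilRank := by
    rw [hr]; exact hord
  have hcoeff' : (PowerSeries.coeff W.mordellWeilRank
      (padicLFunction f (unitRoot W p : ℚ_[p]))).valuation = a := by rw [hr]; exact hcoeff
  obtain ⟨hfin, hSch, -⟩ := finite_sha_and_valuation_eq_of_mainConjecture hS W p f hSU hp hordin.1
    hordin.2 hirr hram hsurj hf Dh hDh hord'
  obtain ⟨-, k, hk, hkval⟩ := card_shaPrimary_eq_pow_of_mainConjecture hS W p f hSU hp hordin.1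
    hordin.2 hirr hram hsurj hf Dh hDh hord' hcoeff' hreg
  refine ⟨hr, hfin, hSch, k, hk, ?_⟩
  rw [hkval, hr, padicValNat_torsionOrder_eq_zero_of_irreducible W p hirr]
  push_cast; ring

/-- **Height-datum-free form of the row theorem at `p ≥ 5`.** THE canonical cyclotomic height datum
exists and is unique at a good ordinary `p ≥ 5` (`existsUnique_isCanonical_holds`, Mazur–Tate /
Mazur–Stein–Tate σ-height), so the regulator valuation `b` may be quoted for "the" canonical
regulator: for EVERY canonical `Dh` with `ord_p Reg_p(E, Dh) = b` the conclusion of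
`card_shaPrimary_eq_pow_of_certificate` holds, and such a `Dh` exists.
[cite: MazurSteinTate2006, Thm. 1.3 and §1] [cite: SkinnerUrban2014, Thm. 3.6.9 (p. 45)]
[cite: BalakrishnanMullerStein2015, Thm. 1.7] -/
theorem card_shaPrimary_eq_pow_of_certificate'
    (hS : Schneider1985_order_charGenerator_odd)
    (W : WeierstrassCurve ℚ) [W.IsElliptic] [W.IsGloballyMinimal] (p : ℕ) [Fact p.Prime]
    {N : ℕ} [NeZero N] (f : CuspForm (Gamma0 N) 2)
    (hSU : ∀ (κ : ZpExtension ℚ p) (γ : Field.absoluteGaloisGroup ℚ),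
      skinner_urban_main_conjecture W p (κ := κ) (γ := γ) (f := f))
    (h5 : 5 ≤ p) (hordin : IsOrdinaryAt W p) (hirr : W.HasIrreducibleModPGaloisRep p)
    (hram : Ram W p) (hf : IsNewformOf W f)
    {r : ℕ} (hlow : r ≤ W.mordellWeilRank)
    (hLp : PowerSeries.coeff r (padicLFunction f (unitRoot W p : ℚ_[p])) ≠ 0) {a : ℤ}
    (hcoeff : (PowerSeries.coeff r (padicLFunction f (unitRoot W p : ℚ_[p]))).valuation = a)
    (b : ℤ) :
    (∃ Dh : PAdicHeightData W p, Dh.IsCanonical) ∧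
      ∀ Dh : PAdicHeightData W p, Dh.IsCanonical → (padicRegulator Dh).valuation = b →
        W.mordellWeilRank = r ∧ Finite (AddCommGroup.primaryComponent W.sha p) ∧
          ∃ k : ℕ, Nat.card (AddCommGroup.primaryComponent W.sha p) = p ^ k ∧
            (k : ℤ) = a + r - 2 * padicValNat p (W.reductionPointCount p) -
              padicValNat p W.tamagawaProduct - b := by
  refine ⟨?_, fun Dh hDh hreg => ?_⟩
  · obtain ⟨Dh, hDh⟩ := WeierstrassCurve.exists_isCanonical_holds W p h5 hordin.1 hordin.2
    exact ⟨Dh, hDh⟩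
  · obtain ⟨hr, hfin, -, hk⟩ := card_shaPrimary_eq_pow_of_certificate hS W p f hSU h5 hordin hirr hram
      hf hlow hLp Dh hDh hcoeff hreg
    exact ⟨hr, hfin, hk⟩

/-! ## §2. The row theorem at `p = 3` -/

/-- **The row theorem at `p = 3`: `#Ш(E/ℚ)[3^∞] = 3^k` at a certified rank-`r` cell `(E, 3)`.**
Skinner–Urban's Thm. 3.6.9 allows `p = 3` (an odd prime throughout S–U) and so does BMS Thm. 1.7
(`p > 2`); what changes against `p ≥ 5`: (i) `3`-adic surjectivity does NOT follow from mod-`3`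
surjectivity in general (Elkies) but DOES at a prime `3` of good reduction — Wuthrich, Doc. Math. 19
(2014), Lemma 20, named fact `hW20` —, mod-`3` surjectivity itself being the tree theorem
`surj_of_irr_of_ram`; (ii) THE canonical `3`-adic height datum `Dh` is a parameter (`hDh`; it exists and
is unique under the tree's `mazur_tate_sigma_exists_odd`, `existsUnique_isCanonical_of_odd`). Otherwise
as `card_shaPrimary_eq_pow_of_certificate`: `rank = r`, `Ш(E/ℚ)[3^∞]` finite, `Reg_3 ≠ 0`,
`#Ш(E/ℚ)[3^∞] = 3^k`, `k = a + r − 2·ord_3 #Ẽ(𝔽_3) − ord_3 ∏c_ℓ − b` (no torsion term: `Irr W 3`). Per pair;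
NOT a class theorem. [cite: SkinnerUrban2014, Thm. 3.6.9 (p. 45)] [cite: Wuthrich2014, Lemma 20 (p. 399)]
[cite: BalakrishnanMullerStein2015, Thm. 1.7] [cite: SteinWuthrich2013, §§3–4, §8 and Alg. 11.1] -/
theorem card_shaPrimary_eq_pow_of_certificate_three
    (hS : Schneider1985_order_charGenerator_odd) (hW20 : lemma20_surjective_threeAdic_of_semistable)
    (W : WeierstrassCurve ℚ) [W.IsElliptic] [W.IsGloballyMinimal]
    {N : ℕ} [NeZero N] (f : CuspForm (Gamma0 N) 2)
    (hSU : ∀ (κ : ZpExtension ℚ 3) (γ : Field.absoluteGaloisGroup ℚ),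
      skinner_urban_main_conjecture W 3 (κ := κ) (γ := γ) (f := f))
    (hordin : IsOrdinaryAt W 3) (hirr : W.HasIrreducibleModPGaloisRep 3)
    (hram : Ram W 3) (hf : IsNewformOf W f)
    {r : ℕ} (hlow : r ≤ W.mordellWeilRank)
    (hLp : PowerSeries.coeff r (padicLFunction f (unitRoot W 3 : ℚ_[3])) ≠ 0)
    (Dh : PAdicHeightData W 3) (hDh : Dh.IsCanonical) {a b : ℤ}
    (hcoeff : (PowerSeries.coeff r (padicLFunction f (unitRoot W 3 : ℚ_[3]))).valuation = a)
    (hreg : (padicRegulator Dh).valuation = b) :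
    W.mordellWeilRank = r ∧ Finite (AddCommGroup.primaryComponent W.sha 3) ∧
      SchneiderConjecture Dh ∧
      ∃ k : ℕ, Nat.card (AddCommGroup.primaryComponent W.sha 3) = 3 ^ k ∧
        (k : ℤ) = a + r - 2 * padicValNat 3 (W.reductionPointCount 3) -
          padicValNat 3 W.tamagawaProduct - b := by
  have hsurj : ∀ n : ℕ, W.HasSurjectiveModNGaloisRep (3 ^ n : ℕ) :=
    hW20 W (Or.inl hordin.1) (surj_of_irr_of_ram W 3 hirr hram)
  obtain ⟨hr, hord⟩ := rank_eq_and_order_eq_of_mainConjecture W 3 f hSU le_rfl hordin.1 hordin.2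
    hirr hram hsurj hf hlow hLp
  have hord' : (padicLFunction f (unitRoot W 3 : ℚ_[3])).order = W.mordellWeilRank := by
    rw [hr]; exact hord
  have hcoeff' : (PowerSeries.coeff W.mordellWeilRank
      (padicLFunction f (unitRoot W 3 : ℚ_[3]))).valuation = a := by rw [hr]; exact hcoeff
  obtain ⟨hfin, hSch, -⟩ := finite_sha_and_valuation_eq_of_mainConjecture hS W 3 f hSU le_rfl
    hordin.1 hordin.2 hirr hram hsurj hf Dh hDh hord'
  obtain ⟨-, k, hk, hkval⟩ := card_shaPrimary_eq_pow_of_mainConjecture hS W 3 f hSU le_rfl hordin.1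
    hordin.2 hirr hram hsurj hf Dh hDh hord' hcoeff' hreg
  refine ⟨hr, hfin, hSch, k, hk, ?_⟩
  rw [hkval, hr, padicValNat_torsionOrder_eq_zero_of_irreducible W 3 hirr]
  push_cast; ring

end Summit.BirchSwinnertonDyer.BirchSwinnertonDyer.Rank2Sha

end
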